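import Summits.CriticalPhenomena.PercolationContinuityZ3.Theorems.PercNearOneGluingNoHeavyLowerTailCubicThreePointInduction
import Mathlib.Tactic.Ring
import Mathlib.Tactic.Linarith
import Mathlib.Tactic.Positivity
import HarnessLib

/-!
# `NoHeavyLowerTail` (stmt-CriticalPhenomena-4575) — the increasing twin `T_inc`: apex-edge Bernstein step and the induction,
# i.e. `T_inc ≥ 0` on EVERY finite weighted graph CONDITIONAL on its two four-point Bernstein inequalities (TB1),(TB2)

Support file (prover prim-e3grp-switch-3, E3GRP switching line; `--supports stmt-CriticalPhenomena-4575`).  No named facts, no sorries; the only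
definitions are the explicit polynomials `Tinc`, `threeTB₁`, `threeTB₂`, the weighted row `tincW` and the hypothesis `StepHypT` (exact twins of
prove-2's `F`, `threeB₁`, `threeB₂`, `shk3W`, `StepHyp` of `…CubicThreePointBernsteinStep` / `…CubicThreePointInduction`, whose framework
(cells with forced edges `evQ/evU₁/evU₂/evU₃/evT`, one-edge split `PrW_split`, sections `sect_ev*`, transitions `trans_*`, frozen case) is reused verbatim).

`T_inc = E₃({a↔b}∪{a↔c}, {a↔b}∪{b↔c}, {a↔c}∪{b↔c}) = (σ + q)(q t − e₂(u)) − e₃(u)` (homogeneous; `…TIncRowPartial`, `…CubicThreePointIncTwin`) is the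
increasing twin of SHK3⁺ `F = (σ + t)(qt − e₂) − e₃`; it is OPEN only in the dense regime `t > q` and generates (with `γ`) the open increasing E3GRP
sunflower class (`…CoSunflowerGlueRows`).  Along an apex edge `e = {x,m}` (`x` forced-joined to `a`) the three-point law moves by the five
transition masses `α₁ (Q→ab|c), α₂ (Q→ac|b), β₁ (ab|c→abc), β₂ (ac|b→abc), β₃ (bc|a→abc)` and
  `T(x_l) = T(x⁰)(1−l)³ + threeTB₁·(1−l)²l + threeTB₂·(1−l)l² + T(x¹)l³`  (`tinc_bernstein_expansion`, by `ring`; `threeTB₁` has 74 terms, `threeTB₂` 115).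
* `StepHypT V` — **(TB1),(TB2)**: `threeTB₁, threeTB₂ ≥ 0` at the cells and transition masses of every `(D, K, p, a, b, c, x ≠ m)` with `x` forced-joined to `a`.
  STEP-0 evidence: 0 violations on 400 + random weighted graphs n ≤ 7 (seat code tbern.py / lawcensus.py; ttrl census 'tinc-apex-bernstein-TB1-TB2' requested);
  certificate search running (oracle-LP, pool X2).  OPEN.
* `tinc_of_stepHypT` — **THEOREM (conditional)**: `StepHypT V → ∀ D K p ∈ [0,1] a b c, 0 ≤ T_inc(law)`; proof = prove-2's induction verbatim (strong induction on
  `|D|`, `step_apexT` at whichever terminal the peeled edge touches, using the terminal symmetry of `T_inc`; frozen terminals ⇒ unit law ⇒ `T_inc = 0`).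
So: certificates for the two four-point cubics (TB1),(TB2) would settle `T_inc` — hence `β` and `r5` — on every finite weighted graph.
-/

noncomputable section

namespace Summit.CriticalPhenomena.PercolationContinuityZ3.Theorems

namespace CubicThreePointStep

open Finset SimpleGraph Literature.Probability.Percolation.DecisionTree

section Algebra

variable {R : Type*} [CommRing R]

/-- The homogeneous cubic `T_inc(q,u₁,u₂,u₃,t) = (σ + q)(q t − e₂(u)) − e₃(u)`, `σ = q+u₁+u₂+u₃+t` (increasing twin of `F`). [folklore] -/
def Tinc (q u₁ u₂ u₃ t : R) : R :=
  (q + u₁ + u₂ + u₃ + t + q) * (q * t - (u₁ * u₂ + u₁ * u₃ + u₂ * u₃)) - u₁ * u₂ * u₃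

/-- Three times the first Bernstein coefficient of `T_inc` along an apex-`a` segment (explicit cubic in the cells of `x⁰` and the
transition masses `α₁, α₂, β₁, β₂, β₃`). [folklore] -/
def threeTB₁ (q u₁ u₂ u₃ t α₁ α₂ β₁ β₂ β₃ : R) : R :=
  3 * q * t * u₁ + 3 * q * t * u₂ + 3 * q * t * u₃ + -3 * q * t * α₁ + -3 * q * t * α₂ + q * t * β₁ + q * t * β₂ + q * t * β₃ + 3 * q * t ^ 2 + -6 * q * u₁ * u₂ + -6 * q * u₁ * u₃ + -2 * q * u₁ * α₂ + q * u₁ * β₁ + 3 * q * u₁ * β₂ + 3 * q * u₁ * β₃ + -6 * q * u₂ * u₃ + -2 * q * u₂ * α₁ + 3 * q * u₂ * β₁ + q * u₂ * β₂ + 3 * q * u₂ * β₃ + -2 * q * u₃ * α₁ + -2 * q * u₃ * α₂ + 3 * q * u₃ * β₁ + 3 * q * u₃ * β₂ + q * u₃ * β₃ + 6 * q ^ 2 * t + 2 * q ^ 2 * β₁ + 2 * q ^ 2 * β₂ + 2 * q ^ 2 * β₃ + -3 * t * u₁ * u₂ + -3 * t * u₁ * u₃ - t * u₁ * α₁ +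 -2 * t * u₁ * α₂ + t * u₁ * β₂ + t * u₁ * β₃ + -3 * t * u₂ * u₃ + -2 * t * u₂ * α₁ - t * u₂ * α₂ + t * u₂ * β₁ + t * u₂ * β₃ + -2 * t * u₃ * α₁ + -2 * t * u₃ * α₂ + t * u₃ * β₁ + t * u₃ * β₂ - t ^ 2 * α₁ - t ^ 2 * α₂ + -12 * u₁ * u₂ * u₃ + u₁ * u₂ * β₁ + u₁ * u₂ * β₂ + 3 * u₁ * u₂ * β₃ + -3 * u₁ * u₂ ^ 2 + -2 * u₁ * u₃ * α₂ + u₁ * u₃ * β₁ + 3 * u₁ * u₃ * β₂ + u₁ * u₃ * β₃ + -3 * u₁ * u₃ ^ 2 + -3 * u₁ ^ 2 * u₂ + -3 * u₁ ^ 2 * u₃ - u₁ ^ 2 * α₂ + u₁ ^ 2 * β₂ + u₁ ^ 2 * β₃ + -2 * u₂ * u₃ * α₁ + 3 * u₂ * u₃ * β₁ + u₂ * u₃ * β₂ + u₂ * u₃ * β₃ + -3 * u₂ * u₃ ^ 2 + -3 * u₂ ^ 2 * u₃ - u₂ ^ 2 * α₁ + u₂ ^ 2 * β₁ + u₂ ^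 2 * β₃ - u₃ ^ 2 * α₁ - u₃ ^ 2 * α₂ + u₃ ^ 2 * β₁ + u₃ ^ 2 * β₂

/-- Three times the second Bernstein coefficient of `T_inc` along an apex-`a` segment (explicit cubic). [folklore] -/
def threeTB₂ (q u₁ u₂ u₃ t α₁ α₂ β₁ β₂ β₃ : R) : R :=
  3 * q * t * u₁ + 3 * q * t * u₂ + 3 * q * t * u₃ + -6 * q * t * α₁ + -6 * q * t * α₂ + 2 * q * t * β₁ + 2 * q * t * β₂ + 2 * q * t * β₃ + 3 * q * t ^ 2 + -6 * q * u₁ * u₂ + -6 * q * u₁ * u₃ + -4 * q * u₁ * α₂ + 2 * q * u₁ * β₁ + 6 * q * u₁ * β₂ + 6 * q * u₁ * β₃ + -6 * q * u₂ * u₃ + -4 * q * u₂ * α₁ + 6 * q * u₂ * β₁ + 2 * q * u₂ * β₂ + 6 * q * u₂ * β₃ + -4 * q * u₃ * α₁ + -4 * q * u₃ * α₂ + 6 * q * u₃ * β₁ + 6 * q * u₃ * β₂ + 2 * q * u₃ * β₃ + -2 * q * α₁ * α₂ + -3 * q * α₁ * β₁ - q * α₁ * β₂ - q * α₁ * β₃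 - q * α₂ * β₁ + -3 * q * α₂ * β₂ - q * α₂ * β₃ + -2 * q * β₁ * β₂ + -2 * q * β₁ * β₃ + -2 * q * β₂ * β₃ + 6 * q ^ 2 * t + 4 * q ^ 2 * β₁ + 4 * q ^ 2 * β₂ + 4 * q ^ 2 * β₃ + -3 * t * u₁ * u₂ + -3 * t * u₁ * u₃ + -2 * t * u₁ * α₁ + -4 * t * u₁ * α₂ + 2 * t * u₁ * β₂ + 2 * t * u₁ * β₃ + -3 * t * u₂ * u₃ + -4 * t * u₂ * α₁ + -2 * t * u₂ * α₂ + 2 * t * u₂ * β₁ + 2 * t * u₂ * β₃ + -4 * t * u₃ * α₁ + -4 * t * u₃ * α₂ + 2 * t * u₃ * β₁ + 2 * t * u₃ * β₂ + t * α₁ * α₂ - t * α₁ * β₁ + t * α₁ ^ 2 - t * α₂ * β₂ + t * α₂ ^ 2 - t * β₁ * β₂ - t * β₁ * β₃ - t * β₂ * β₃ + -2 * t ^ 2 * α₁ + -2 * t ^ 2 * α₂ + -12 * u₁ * u₂ * u₃ + 2 * u₁ * u₂ * β₁ + 2 * u₁ * u₂ * β₂ + 6 * u₁ * u₂ * β₃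 + -3 * u₁ * u₂ ^ 2 + -4 * u₁ * u₃ * α₂ + 2 * u₁ * u₃ * β₁ + 6 * u₁ * u₃ * β₂ + 2 * u₁ * u₃ * β₃ + -3 * u₁ * u₃ ^ 2 - u₁ * α₁ * β₁ - u₁ * α₁ * β₂ - u₁ * α₁ * β₃ + -2 * u₁ * α₂ * β₂ + u₁ * α₂ ^ 2 - u₁ * β₁ * β₂ - u₁ * β₁ * β₃ + -2 * u₁ * β₂ * β₃ + -3 * u₁ ^ 2 * u₂ + -3 * u₁ ^ 2 * u₃ + -2 * u₁ ^ 2 * α₂ + 2 * u₁ ^ 2 * β₂ + 2 * u₁ ^ 2 * β₃ + -4 * u₂ * u₃ * α₁ + 6 * u₂ * u₃ * β₁ + 2 * u₂ * u₃ * β₂ + 2 * u₂ * u₃ * β₃ + -3 * u₂ * u₃ ^ 2 + -2 * u₂ * α₁ * β₁ + u₂ * α₁ ^ 2 - u₂ * α₂ * β₁ - u₂ * α₂ * β₂ - u₂ * α₂ * β₃ - u₂ * β₁ * β₂ + -2 * u₂ * β₁ * β₃ - u₂ * β₂ * β₃ + -3 * u₂ ^ 2 * u₃ + -2 * u₂ ^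 2 * α₁ + 2 * u₂ ^ 2 * β₁ + 2 * u₂ ^ 2 * β₃ + -2 * u₃ * α₁ * β₁ + u₃ * α₁ ^ 2 + -2 * u₃ * α₂ * β₂ + u₃ * α₂ ^ 2 + -2 * u₃ * β₁ * β₂ - u₃ * β₁ * β₃ - u₃ * β₂ * β₃ + -2 * u₃ ^ 2 * α₁ + -2 * u₃ ^ 2 * α₂ + 2 * u₃ ^ 2 * β₁ + 2 * u₃ ^ 2 * β₂

/-- **Bernstein expansion of `T_inc` along an apex edge** (`x¹ = (q−α₁−α₂, u₁+α₁−β₁, u₂+α₂−β₂, u₃−β₃, t+β₁+β₂+β₃)`, `x_l = (1−l)x⁰ + l x¹`):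
`T(x_l) = T(x⁰)(1−l)³ + threeTB₁·(1−l)²l + threeTB₂·(1−l)l² + T(x¹)l³`. [folklore] -/
theorem tinc_bernstein_expansion (q u₁ u₂ u₃ t α₁ α₂ β₁ β₂ β₃ l : R) :
    Tinc (q + l * (-α₁ - α₂)) (u₁ + l * (α₁ - β₁)) (u₂ + l * (α₂ - β₂)) (u₃ + l * (-β₃)) (t + l * (β₁ + β₂ + β₃)) =
      Tinc q u₁ u₂ u₃ t * (1 - l) ^ 3 + threeTB₁ q u₁ u₂ u₃ t α₁ α₂ β₁ β₂ β₃ * ((1 - l) ^ 2 * l) +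
        threeTB₂ q u₁ u₂ u₃ t α₁ α₂ β₁ β₂ β₃ * ((1 - l) * l ^ 2) +
        Tinc (q - α₁ - α₂) (u₁ + α₁ - β₁) (u₂ + α₂ - β₂) (u₃ - β₃) (t + β₁ + β₂ + β₃) * l ^ 3 := by
  simp only [Tinc, threeTB₁, threeTB₂]
  ring

/-- **The apex step for `T_inc`.**  `T_inc ≥ 0` at both endpoint laws and `threeTB₁, threeTB₂ ≥ 0` give `T_inc ≥ 0` along the whole apex segment. [folklore] -/
theorem Tinc_segment_nonneg_of_bernstein {q u₁ u₂ u₃ t α₁ α₂ β₁ β₂ β₃ l : ℝ}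
    (h₀ : 0 ≤ Tinc q u₁ u₂ u₃ t) (h₃ : 0 ≤ Tinc (q - α₁ - α₂) (u₁ + α₁ - β₁) (u₂ + α₂ - β₂) (u₃ - β₃) (t + β₁ + β₂ + β₃))
    (h₁ : 0 ≤ threeTB₁ q u₁ u₂ u₃ t α₁ α₂ β₁ β₂ β₃) (h₂ : 0 ≤ threeTB₂ q u₁ u₂ u₃ t α₁ α₂ β₁ β₂ β₃)
    (hl₀ : 0 ≤ l) (hl₁ : l ≤ 1) :
    0 ≤ Tinc (q + l * (-α₁ - α₂)) (u₁ + l * (α₁ - β₁)) (u₂ + l * (α₂ - β₂)) (u₃ + l * (-β₃)) (t + l * (β₁ + β₂ + β₃)) := by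
  rw [tinc_bernstein_expansion]
  exact bernstein_cubic_nonneg h₀ h₁ h₂ h₃ hl₀ hl₁

/-- The five unit vectors are zeros of `T_inc` (deterministic laws). [folklore] -/
theorem Tinc_unit_eq_zero :
    Tinc (1 : ℝ) 0 0 0 0 = 0 ∧ Tinc (0 : ℝ) 1 0 0 0 = 0 ∧ Tinc (0 : ℝ) 0 1 0 0 = 0 ∧ Tinc (0 : ℝ) 0 0 1 0 = 0 ∧
      Tinc (0 : ℝ) 0 0 0 1 = 0 := by
  refine ⟨?_, ?_, ?_, ?_, ?_⟩ <;> norm_num [Tinc]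

end Algebra

variable {V : Type*} [DecidableEq V]

/-- The weighted increasing-twin row: `T_inc` evaluated on the five cells of the three-point law with forced set `K`. [folklore] -/
def tincW (D : Finset (Sym2 V)) (p : Sym2 V → ℝ) (K : Finset (Sym2 V)) (a b c : V) : ℝ :=
  Tinc (PrW D p (evQ K a b c)) (PrW D p (evU₁ K a b c)) (PrW D p (evU₂ K a b c)) (PrW D p (evU₃ K a b c))
    (PrW D p (evT K a b c))

section Symmetry

variable (D : Finset (Sym2 V)) (p : Sym2 V → ℝ) (K : Finset (Sym2 V)) (a b c : V)

/-- `T_inc` is symmetric in the terminals: swapping `a,b`. [folklore] -/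
theorem tincW_swap12 : tincW D p K b a c = tincW D p K a b c := by
  unfold tincW
  rw [evT_swap12 K a b c, evU₁_swap12 K a b c, evU₂_swap12 K a b c, evU₃_swap12 K a b c, evQ_swap12 K a b c]
  simp only [Tinc]
  ring

/-- `T_inc` is symmetric in the terminals: swapping `a,c`. [folklore] -/
theorem tincW_swap13 : tincW D p K c b a = tincW D p K a b c := by
  unfold tincW
  rw [evT_swap13 K a b c, evU₁_swap13 K a b c, evU₂_swap13 K a b c, evU₃_swap13 K a b c, evQ_swap13 K a b c]
  simp only [Tinc]
  ring

end Symmetry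

/-- `T_inc` vanishes when the three terminals are frozen (the law is a unit vector). [folklore] -/
theorem tincW_eq_zero_of_frozen (D : Finset (Sym2 V)) (p : Sym2 V → ℝ) (K : Finset (Sym2 V)) (a b c : V)
    (ha : ∀ e ∈ D, ∀ y z : V, e = s(y, z) → y ≠ z → ¬ R K ∅ a y)
    (hb : ∀ e ∈ D, ∀ y z : V, e = s(y, z) → y ≠ z → ¬ R K ∅ b y) :
    tincW D p K a b c = 0 := by
  have eab : ∀ S, S ⊆ D → (R K S a b ↔ R K ∅ a b) := fun S hS => frozen_iff ha hS b
  have eac : ∀ S, S ⊆ D → (R K S a c ↔ R K ∅ a c) := fun S hS => frozen_iff ha hS c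
  have ebc : ∀ S, S ⊆ D → (R K S b c ↔ R K ∅ b c) := fun S hS => frozen_iff hb hS c
  obtain ⟨f1, f2, f3, f4, f5⟩ := Tinc_unit_eq_zero
  unfold tincW
  by_cases Pab : R K ∅ a b
  · by_cases Pac : R K ∅ a c
    · rw [PrW_eq_zero_of_forall D p (fun S hS h => h.1 ((eab S hS).2 Pab)),
        PrW_eq_zero_of_forall D p (fun S hS h => h.2 ((eac S hS).2 Pac)),
        PrW_eq_zero_of_forall D p (fun S hS h => h.2 ((eab S hS).2 Pab)),
        PrW_eq_zero_of_forall D p (fun S hS h => h.2 ((eab S hS).2 Pab)),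
        PrW_eq_one_of_forall D p (fun S hS => show S ∈ evT K a b c from ⟨(eab S hS).2 Pab, (eac S hS).2 Pac⟩)]
      exact f5
    · rw [PrW_eq_zero_of_forall D p (fun S hS h => h.1 ((eab S hS).2 Pab)),
        PrW_eq_one_of_forall D p (fun S hS => show S ∈ evU₁ K a b c from ⟨(eab S hS).2 Pab, fun h => Pac ((eac S hS).1 h)⟩),
        PrW_eq_zero_of_forall D p (fun S hS h => Pac ((eac S hS).1 h.1)),
        PrW_eq_zero_of_forall D p (fun S hS h => h.2 ((eab S hS).2 Pab)),
        PrW_eq_zero_of_forall D p (fun S hS h => Pac ((eac S hS).1 h.2))]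
      exact f2
  · by_cases Pac : R K ∅ a c
    · have Pbc : ¬ R K ∅ b c := fun h => Pab (Pac.trans h.symm)
      rw [PrW_eq_zero_of_forall D p (fun S hS h => h.2.1 ((eac S hS).2 Pac)),
        PrW_eq_zero_of_forall D p (fun S hS h => Pab ((eab S hS).1 h.1)),
        PrW_eq_one_of_forall D p (fun S hS => show S ∈ evU₂ K a b c from ⟨(eac S hS).2 Pac, fun h => Pab ((eab S hS).1 h)⟩),
        PrW_eq_zero_of_forall D p (fun S hS h => Pbc ((ebc S hS).1 h.1)),
        PrW_eq_zero_of_forall D p (fun S hS h => Pab ((eab S hS).1 h.1))]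
      exact f3
    · by_cases Pbc : R K ∅ b c
      · rw [PrW_eq_zero_of_forall D p (fun S hS h => h.2.2 ((ebc S hS).2 Pbc)),
          PrW_eq_zero_of_forall D p (fun S hS h => Pab ((eab S hS).1 h.1)),
          PrW_eq_zero_of_forall D p (fun S hS h => Pac ((eac S hS).1 h.1)),
          PrW_eq_one_of_forall D p (fun S hS => show S ∈ evU₃ K a b c from ⟨(ebc S hS).2 Pbc, fun h => Pab ((eab S hS).1 h)⟩),
          PrW_eq_zero_of_forall D p (fun S hS h => Pab ((eab S hS).1 h.1))]
        exact f4
      · rw [PrW_eq_one_of_forall D p (fun S hS => show S ∈ evQ K a b c from ⟨fun h => Pab ((eab S hS).1 h),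
            fun h => Pac ((eac S hS).1 h), fun h => Pbc ((ebc S hS).1 h)⟩),
          PrW_eq_zero_of_forall D p (fun S hS h => Pab ((eab S hS).1 h.1)),
          PrW_eq_zero_of_forall D p (fun S hS h => Pac ((eac S hS).1 h.1)),
          PrW_eq_zero_of_forall D p (fun S hS h => Pbc ((ebc S hS).1 h.1)),
          PrW_eq_zero_of_forall D p (fun S hS h => Pab ((eab S hS).1 h.1))]
        exact f1

/-- **(TB1),(TB2) of the apex-edge induction for `T_inc`, as a hypothesis.**  For every random-edge set `D`, forced set `K`, weights
`p ∈ [0,1]`, terminals `a,b,c` and apex edge `{x,m}` (`x ≠ m`, `x` forced-joined to `a`): `threeTB₁, threeTB₂ ≥ 0` at the cells of the law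
with forced set `K` and the five transition masses towards `K ∪ {{x,m}}`.  OPEN (STEP-0: 0 violations on random weighted graphs; census and
certificate searches filed 2026-08-20). [folklore] -/
def StepHypT (V : Type*) [DecidableEq V] : Prop :=
  ∀ (D K : Finset (Sym2 V)) (p : Sym2 V → ℝ), (∀ i, 0 ≤ p i) → (∀ i, p i ≤ 1) →
    ∀ (a b c x m : V), x ≠ m → (∀ S : Finset (Sym2 V), R K S a x) →
      0 ≤ threeTB₁ (PrW D p (evQ K a b c)) (PrW D p (evU₁ K a b c)) (PrW D p (evU₂ K a b c))
            (PrW D p (evU₃ K a b c)) (PrW D p (evT K a b c))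
            (PrW D p (evQ K a b c ∩ evU₁ (insert s(x, m) K) a b c))
            (PrW D p (evQ K a b c ∩ evU₂ (insert s(x, m) K) a b c))
            (PrW D p (evU₁ K a b c ∩ evT (insert s(x, m) K) a b c))
            (PrW D p (evU₂ K a b c ∩ evT (insert s(x, m) K) a b c))
            (PrW D p (evU₃ K a b c ∩ evT (insert s(x, m) K) a b c)) ∧
        0 ≤ threeTB₂ (PrW D p (evQ K a b c)) (PrW D p (evU₁ K a b c)) (PrW D p (evU₂ K a b c))
            (PrW D p (evU₃ K a b c)) (PrW D p (evT K a b c))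
            (PrW D p (evQ K a b c ∩ evU₁ (insert s(x, m) K) a b c))
            (PrW D p (evQ K a b c ∩ evU₂ (insert s(x, m) K) a b c))
            (PrW D p (evU₁ K a b c ∩ evT (insert s(x, m) K) a b c))
            (PrW D p (evU₂ K a b c ∩ evT (insert s(x, m) K) a b c))
            (PrW D p (evU₃ K a b c ∩ evT (insert s(x, m) K) a b c))

section Induction

variable {p : Sym2 V → ℝ} (hp0 : ∀ i, 0 ≤ p i) (hp1 : ∀ i, p i ≤ 1)
include hp0 hp1

/-- **The apex step for `T_inc`.**  If `e = {x,m} ∈ D`, `x ≠ m`, `x` is forced-joined to `a`, `T_inc ≥ 0` holds for `(D ∖ e, K)` and `(D ∖ e, K ∪ {e})`,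
and (TB1),(TB2) hold, then `T_inc ≥ 0` for `(D, K)`. [folklore] -/
theorem step_apexT (hstep : StepHypT V) {D K : Finset (Sym2 V)} {a b c x m : V} (hxm : x ≠ m)
    (hax : ∀ S : Finset (Sym2 V), R K S a x) (he : s(x, m) ∈ D)
    (ih0 : 0 ≤ tincW (D.erase s(x, m)) p K a b c) (ih1 : 0 ≤ tincW (D.erase s(x, m)) p (insert s(x, m) K) a b c) :
    0 ≤ tincW D p K a b c := by
  set e := s(x, m) with he_def
  set D' := D.erase e with hD'
  have heD' : e ∉ D' := Finset.notMem_erase e D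
  have hD : D = insert e D' := (Finset.insert_erase he).symm
  have sq : PrW D p (evQ K a b c) = (1 - p e) * PrW D' p (evQ K a b c) + p e * PrW D' p (evQ (insert e K) a b c) := by
    rw [hD, PrW_split D' p heD', sect_evQ]
  have s1 : PrW D p (evU₁ K a b c) = (1 - p e) * PrW D' p (evU₁ K a b c) + p e * PrW D' p (evU₁ (insert e K) a b c) := by
    rw [hD, PrW_split D' p heD', sect_evU₁]
  have s2 : PrW D p (evU₂ K a b c) = (1 - p e) * PrW D' p (evU₂ K a b c) + p e * PrW D' p (evU₂ (insert e K) a b c) := by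
    rw [hD, PrW_split D' p heD', sect_evU₂]
  have s3 : PrW D p (evU₃ K a b c) = (1 - p e) * PrW D' p (evU₃ K a b c) + p e * PrW D' p (evU₃ (insert e K) a b c) := by
    rw [hD, PrW_split D' p heD', sect_evU₃]
  have sT : PrW D p (evT K a b c) = (1 - p e) * PrW D' p (evT K a b c) + p e * PrW D' p (evT (insert e K) a b c) := by
    rw [hD, PrW_split D' p heD', sect_evT]
  have tQ := trans_Q D' p (K := K) (b := b) (c := c) (m := m) hax
  have t1 := trans_U₁ D' p (K := K) (a := a) (b := b) (c := c) (x := x) (m := m)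
  have t2 := trans_U₂ D' p (K := K) (a := a) (b := b) (c := c) (x := x) (m := m)
  have t3 := trans_U₃ D' p (K := K) (b := b) (c := c) (m := m) hax
  have tT := trans_T D' p (K := K) (b := b) (c := c) (m := m) hax
  set q := PrW D' p (evQ K a b c)
  set u₁ := PrW D' p (evU₁ K a b c)
  set u₂ := PrW D' p (evU₂ K a b c)
  set u₃ := PrW D' p (evU₃ K a b c)
  set t := PrW D' p (evT K a b c)
  set α₁ := PrW D' p (evQ K a b c ∩ evU₁ (insert e K) a b c)
  set α₂ := PrW D' p (evQ K a b c ∩ evU₂ (insert e K) a b c)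
  set β₁ := PrW D' p (evU₁ K a b c ∩ evT (insert e K) a b c)
  set β₂ := PrW D' p (evU₂ K a b c ∩ evT (insert e K) a b c)
  set β₃ := PrW D' p (evU₃ K a b c ∩ evT (insert e K) a b c)
  have hq1 : PrW D' p (evQ (insert e K) a b c) = q - α₁ - α₂ := by linarith
  have hu1 : PrW D' p (evU₁ (insert e K) a b c) = u₁ + α₁ - β₁ := by linarith
  have hu2 : PrW D' p (evU₂ (insert e K) a b c) = u₂ + α₂ - β₂ := by linarith
  have hu3 : PrW D' p (evU₃ (insert e K) a b c) = u₃ - β₃ := by linarith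
  have ht1 : PrW D' p (evT (insert e K) a b c) = t + β₁ + β₂ + β₃ := by linarith
  obtain ⟨hB1, hB2⟩ := hstep D' K p hp0 hp1 a b c x m hxm hax
  have h3 : 0 ≤ Tinc (q - α₁ - α₂) (u₁ + α₁ - β₁) (u₂ + α₂ - β₂) (u₃ - β₃) (t + β₁ + β₂ + β₃) := by
    have := ih1
    unfold tincW at this
    rwa [hq1, hu1, hu2, hu3, ht1] at this
  have h0 : 0 ≤ Tinc q u₁ u₂ u₃ t := ih0
  have key := Tinc_segment_nonneg_of_bernstein h0 h3 hB1 hB2 (hp0 e) (hp1 e)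
  unfold tincW
  rw [sq, s1, s2, s3, sT, hq1, hu1, hu2, hu3, ht1]
  have e1 : (1 - p e) * q + p e * (q - α₁ - α₂) = q + p e * (-α₁ - α₂) := by ring
  have e2 : (1 - p e) * u₁ + p e * (u₁ + α₁ - β₁) = u₁ + p e * (α₁ - β₁) := by ring
  have e3 : (1 - p e) * u₂ + p e * (u₂ + α₂ - β₂) = u₂ + p e * (α₂ - β₂) := by ring
  have e4 : (1 - p e) * u₃ + p e * (u₃ - β₃) = u₃ + p e * (-β₃) := by ring
  have e5 : (1 - p e) * t + p e * (t + β₁ + β₂ + β₃) = t + p e * (β₁ + β₂ + β₃) := by ring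
  rw [e1, e2, e3, e4, e5]
  exact key

/-- **`T_inc ≥ 0` for every finite weighted graph, from the step hypothesis (TB1),(TB2)** (strong induction on the number of random edges;
frozen case `tincW_eq_zero_of_frozen`, step `step_apexT` at whichever terminal the chosen edge touches, moved to `a` by the terminal symmetry). [folklore] -/
theorem tincW_nonneg_of_stepHypT (hstep : StepHypT V) :
    ∀ (n : ℕ) (D K : Finset (Sym2 V)) (a b c : V), D.card = n → 0 ≤ tincW D p K a b c := by
  intro n
  induction n using Nat.strong_induction_on with
  | _ n ih =>
  intro D K a b c hDn
  by_cases hex : ∃ e ∈ D, ∃ y z : V, e = s(y, z) ∧ y ≠ z ∧ (R K ∅ a y ∨ R K ∅ b y ∨ R K ∅ c y)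
  · obtain ⟨e, heD, y, z, rfl, hyz, hreach⟩ := hex
    have hlt : (D.erase s(y, z)).card < n := by rw [← hDn]; exact Finset.card_erase_lt_of_mem heD
    have IH : ∀ (K' : Finset (Sym2 V)) (a' b' c' : V), 0 ≤ tincW (D.erase s(y, z)) p K' a' b' c' :=
      fun K' a' b' c' => ih _ hlt _ K' a' b' c' rfl
    rcases hreach with h | h | h
    · exact step_apexT hp0 hp1 hstep hyz (fun S => R_mono_config (Finset.empty_subset S) h) heD (IH _ _ _ _) (IH _ _ _ _)
    · rw [← tincW_swap12]
      exact step_apexT hp0 hp1 hstep hyz (fun S => R_mono_config (Finset.empty_subset S) h) heD (IH _ _ _ _) (IH _ _ _ _)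
    · rw [← tincW_swap13]
      exact step_apexT hp0 hp1 hstep hyz (fun S => R_mono_config (Finset.empty_subset S) h) heD (IH _ _ _ _) (IH _ _ _ _)
  · push Not at hex
    have ha : ∀ e ∈ D, ∀ y z : V, e = s(y, z) → y ≠ z → ¬ R K ∅ a y :=
      fun e he y z hyz hne => (hex e he y z hyz hne).1
    have hb : ∀ e ∈ D, ∀ y z : V, e = s(y, z) → y ≠ z → ¬ R K ∅ b y :=
      fun e he y z hyz hne => (hex e he y z hyz hne).2.1
    rw [tincW_eq_zero_of_frozen D p K a b c ha hb]

/-- **`T_inc ≥ 0` (the increasing twin of 3PT-LB: Richards–Sahi `E₃ ≥ 0` on the three 'joined to another terminal' events) for bond percolation on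
every finite graph with arbitrary edge weights, CONDITIONAL on the apex Bernstein inequalities (TB1),(TB2)** — finitary form:
for every random-edge set `D`, forced set `K`, weights `p ∈ [0,1]` and terminals `a,b,c`, `(σ+q)(q t − e₂(u)) ≥ e₃(u)`. [folklore] -/
theorem tinc_of_stepHypT (hstep : StepHypT V) (D K : Finset (Sym2 V)) (a b c : V) :
    0 ≤ Tinc (PrW D p (evQ K a b c)) (PrW D p (evU₁ K a b c)) (PrW D p (evU₂ K a b c)) (PrW D p (evU₃ K a b c))
      (PrW D p (evT K a b c)) :=
  tincW_nonneg_of_stepHypT hp0 hp1 hstep D.card D K a b c rfl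

end Induction

end CubicThreePointStep

end Summit.CriticalPhenomena.PercolationContinuityZ3.Theorems

end
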